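import Mathlib
import HarnessLib

/-!
# SoloInformed — fibre intervals with extended endpoints: shapes, substitution, exclusion

Solo programme `solo-KontsevichZagierPeriods-informed`, attempt (A390-ii), file F2a of the
KERNEL LEMMA I programme (integrability loci of `ℚ`-semialgebraic families are
`ℚ`-semialgebraic, via the vendored Lion–Rolin preparation fact
`Literature.ModelTheory.ExponentialFields.semialgebraicPreparation`).

A vertical fibre of a band of a cylindrical decomposition is an open interval of `ℝ` whose
endpoints live in `EReal` (`Literature.…CylindricalDecomposition.bandOver`, `bandLower`,
`bandUpper`).  This file provides:

* `soloInformedEIoo l u` — the interval `{y : ℝ | l < y < u}` for `l u : EReal`, its real shapes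
  (`Ioo`, `Ioi`, `Iio`), measurability, the side dichotomy for a point off the fibre, and
  finiteness of the endpoint on the side of such a point;
* translation / reflection of set integrals (`y = θ + s`, `y = θ - s`) carrying a fibre lying on
  one side of the centre `θ` of a prepared term onto a NORMALISED fibre
  `soloInformedEIoo α₀ β` (`0 ≤ α₀`), in the normal variable `s = |y - θ|`, the other centres
  `θ'ᵢ` becoming the points `dᵢ = ±(θ'ᵢ - θ)` (`soloInformed_fibre_subst_above/below`);
* transfer of exclusion: a centre off the fibre stays off the normalised fibre
  (`soloInformed_excluded_above/below`).

References: Lion–Rolin, Ann. Inst. Fourier 48 (1998) 755–767, §1 (`LionRolin1998`);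
Basu–Pollack–Roy, Algorithms in Real Algebraic Geometry (2006), §5.1 (`BasuPollackRoy2006`).
-/

noncomputable section

open MeasureTheory Set Real
open scoped ENNReal

namespace Summit.KontsevichZagierPeriods.KontsevichZagierPeriods.Theorems

/-! ### Open intervals of `ℝ` with endpoints in `EReal` -/

/-- The open interval `{y : ℝ | l < y < u}` with extended endpoints `l u : EReal` — the shape of
a vertical fibre of a band of a cylindrical decomposition. [cite: BasuPollackRoy2006, §5.1] -/
def soloInformedEIoo (l u : EReal) : Set ℝ := {y : ℝ | l < (y : EReal) ∧ (y : EReal) < u}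

/-- Membership in `soloInformedEIoo`. [cite: BasuPollackRoy2006, §5.1] -/
theorem soloInformed_mem_EIoo {l u : EReal} {y : ℝ} :
    y ∈ soloInformedEIoo l u ↔ l < (y : EReal) ∧ (y : EReal) < u := Iff.rfl

/-- Two real endpoints: `Ioo`. [cite: BasuPollackRoy2006, §5.1] -/
theorem soloInformed_EIoo_coe_coe (a b : ℝ) : soloInformedEIoo a b = Ioo a b := by
  ext y; simp [soloInformedEIoo, EReal.coe_lt_coe_iff]

/-- Real lower endpoint and `u = ⊤`: `Ioi`. [cite: BasuPollackRoy2006, §5.1] -/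
theorem soloInformed_EIoo_coe_top (a : ℝ) : soloInformedEIoo a ⊤ = Ioi a := by
  ext y; simp [soloInformedEIoo, EReal.coe_lt_coe_iff, EReal.coe_lt_top]

/-- `l = ⊥` and real upper endpoint: `Iio`. [cite: BasuPollackRoy2006, §5.1] -/
theorem soloInformed_EIoo_bot_coe (b : ℝ) : soloInformedEIoo ⊥ b = Iio b := by
  ext y; simp [soloInformedEIoo, EReal.coe_lt_coe_iff, EReal.bot_lt_coe]

/-- `soloInformedEIoo l u` is measurable (preimage of `Ioo l u` under the measurable coercion
`ℝ → EReal`). [cite: BasuPollackRoy2006, §5.1] -/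
theorem soloInformed_measurableSet_EIoo (l u : EReal) : MeasurableSet (soloInformedEIoo l u) := by
  change MeasurableSet (((↑) : ℝ → EReal) ⁻¹' Ioo l u)
  exact measurable_coe_real_ereal measurableSet_Ioo

/-- A point off a fibre interval lies (weakly) below or above it. [cite: BasuPollackRoy2006, §5.1] -/
theorem soloInformed_EIoo_side {l u : EReal} {θ : ℝ} (hθ : θ ∉ soloInformedEIoo l u) :
    (θ : EReal) ≤ l ∨ u ≤ (θ : EReal) := by
  by_contra h
  rw [not_or, not_le, not_le] at h
  exact hθ h

/-- If a real point lies below a nonempty fibre interval, its lower endpoint is real.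
[cite: BasuPollackRoy2006, §5.1] -/
theorem soloInformed_EIoo_lower_eq_coe {l u : EReal} {θ : ℝ} (hθl : (θ : EReal) ≤ l)
    (hlu : l < u) : l = ((l.toReal : ℝ) : EReal) :=
  (EReal.coe_toReal (ne_top_of_lt hlu)
    (ne_bot_of_gt (lt_of_lt_of_le (EReal.bot_lt_coe θ) hθl))).symm

/-- If a real point lies above a nonempty fibre interval, its upper endpoint is real.
[cite: BasuPollackRoy2006, §5.1] -/
theorem soloInformed_EIoo_upper_eq_coe {l u : EReal} {θ : ℝ} (huθ : u ≤ (θ : EReal))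
    (hlu : l < u) : u = ((u.toReal : ℝ) : EReal) :=
  (EReal.coe_toReal (ne_top_of_le_ne_top (EReal.coe_ne_top θ) huθ) (ne_bot_of_gt hlu)).symm

/-! ### Translation and reflection of set integrals -/

/-- Translating a set integral on `ℝ`: `∫⁻_{A} φ = ∫⁻_{s | θ + s ∈ A} φ (θ + s)`.
[cite: LionRolin1998, §1] -/
theorem soloInformed_setLIntegral_comp_const_add {A : Set ℝ} (hA : MeasurableSet A)
    (φ : ℝ → ℝ≥0∞) (θ : ℝ) :
    ∫⁻ y in A, φ y = ∫⁻ s in (fun s => θ + s) ⁻¹' A, φ (θ + s) := by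
  have hA' : MeasurableSet ((fun s => θ + s) ⁻¹' A) := (measurable_id.const_add θ) hA
  rw [← lintegral_indicator hA, ← lintegral_indicator hA',
    ← lintegral_add_left_eq_self (fun y => A.indicator φ y) θ]
  congr 1 with s

/-- Reflecting a set integral on `ℝ`: `∫⁻_{A} φ = ∫⁻_{s | θ - s ∈ A} φ (θ - s)`.
[cite: LionRolin1998, §1] -/
theorem soloInformed_setLIntegral_comp_const_sub {A : Set ℝ} (hA : MeasurableSet A)
    (φ : ℝ → ℝ≥0∞) (θ : ℝ) :
    ∫⁻ y in A, φ y = ∫⁻ s in (fun s => θ - s) ⁻¹' A, φ (θ - s) := by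
  have hA' : MeasurableSet ((fun s => θ - s) ⁻¹' A) := (measurable_id.const_sub θ) hA
  rw [← lintegral_indicator hA, ← lintegral_indicator hA',
    ← lintegral_sub_left_eq_self (fun y => A.indicator φ y) θ]
  congr 1 with s

/-- The translate `s ↦ θ + s` pulls the fibre `(l₀, u)` back to `(l₀ - θ, u - θ)`.
[cite: BasuPollackRoy2006, §5.1] -/
theorem soloInformed_preimage_const_add_EIoo (l₀ θ : ℝ) (u : EReal) :
    (fun s => θ + s) ⁻¹' soloInformedEIoo l₀ u =
      soloInformedEIoo ((l₀ - θ : ℝ) : EReal) (u - θ) := by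
  ext s
  simp only [mem_preimage, soloInformed_mem_EIoo]
  induction u using EReal.rec with
  | bot => simp
  | coe u₀ =>
    rw [← EReal.coe_sub]
    simp only [EReal.coe_lt_coe_iff]
    constructor <;> rintro ⟨h1, h2⟩ <;> constructor <;> linarith
  | top =>
    rw [EReal.top_sub_coe]
    simp only [EReal.coe_lt_coe_iff, EReal.coe_lt_top, and_true]
    constructor <;> intro h <;> linarith

/-- The reflection `s ↦ θ - s` pulls the fibre `(l, u₀)` back to `(θ - u₀, θ - l)`.
[cite: BasuPollackRoy2006, §5.1] -/
theorem soloInformed_preimage_const_sub_EIoo (u₀ θ : ℝ) (l : EReal) :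
    (fun s => θ - s) ⁻¹' soloInformedEIoo l u₀ =
      soloInformedEIoo ((θ - u₀ : ℝ) : EReal) (θ - l) := by
  ext s
  simp only [mem_preimage, soloInformed_mem_EIoo]
  induction l using EReal.rec with
  | bot =>
    rw [EReal.coe_sub_bot]
    simp only [EReal.coe_lt_coe_iff, EReal.bot_lt_coe, EReal.coe_lt_top, true_and, and_true]
    constructor <;> intro h <;> linarith
  | coe l₀ =>
    rw [← EReal.coe_sub]
    simp only [EReal.coe_lt_coe_iff]
    constructor <;> rintro ⟨h1, h2⟩ <;> constructor <;> linarith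
  | top => simp

/-- Normal variable on a fibre lying ABOVE the centre `θ` (`θ ≤ l`): substituting `y = θ + s`
turns `∫⁻_{(l,u)} Ψ |y-θ| (|y-θ'ᵢ|)ᵢ` into `∫⁻_{(l-θ, u-θ)} Ψ s (|s-(θ'ᵢ-θ)|)ᵢ`.
[cite: LionRolin1998, §1] -/
theorem soloInformed_fibre_subst_above {N : ℕ} {l u : EReal} {θ : ℝ} (hθl : (θ : EReal) ≤ l)
    (hlu : l < u) (θ' : Fin N → ℝ) (Ψ : ℝ → (Fin N → ℝ) → ℝ≥0∞) :
    ∫⁻ y in soloInformedEIoo l u, Ψ (|y - θ|) (fun i => |y - θ' i|) =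
      ∫⁻ s in soloInformedEIoo ((l.toReal - θ : ℝ) : EReal) (u - θ),
        Ψ s (fun i => |s - (θ' i - θ)|) := by
  obtain ⟨l₀, rfl⟩ : ∃ l₀ : ℝ, l = (l₀ : EReal) := ⟨l.toReal, soloInformed_EIoo_lower_eq_coe hθl hlu⟩
  have hθl₀ : θ ≤ l₀ := by exact_mod_cast hθl
  rw [EReal.toReal_coe, soloInformed_setLIntegral_comp_const_add
    (soloInformed_measurableSet_EIoo _ _) _ θ, soloInformed_preimage_const_add_EIoo]
  refine setLIntegral_congr_fun (soloInformed_measurableSet_EIoo _ _) (fun s hs => ?_)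
  have hs0 : 0 < s := by
    have h1 := hs.1
    rw [EReal.coe_lt_coe_iff] at h1
    linarith
  simp only [add_sub_cancel_left, abs_of_pos hs0]
  congr 1
  funext i
  congr 1
  ring

/-- Normal variable on a fibre lying BELOW the centre `θ` (`u ≤ θ`): substituting `y = θ - s`
turns `∫⁻_{(l,u)} Ψ |y-θ| (|y-θ'ᵢ|)ᵢ` into `∫⁻_{(θ-u, θ-l)} Ψ s (|s-(θ-θ'ᵢ)|)ᵢ`.
[cite: LionRolin1998, §1] -/
theorem soloInformed_fibre_subst_below {N : ℕ} {l u : EReal} {θ : ℝ} (huθ : u ≤ (θ : EReal))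
    (hlu : l < u) (θ' : Fin N → ℝ) (Ψ : ℝ → (Fin N → ℝ) → ℝ≥0∞) :
    ∫⁻ y in soloInformedEIoo l u, Ψ (|y - θ|) (fun i => |y - θ' i|) =
      ∫⁻ s in soloInformedEIoo ((θ - u.toReal : ℝ) : EReal) (θ - l),
        Ψ s (fun i => |s - (θ - θ' i)|) := by
  obtain ⟨u₀, rfl⟩ : ∃ u₀ : ℝ, u = (u₀ : EReal) := ⟨u.toReal, soloInformed_EIoo_upper_eq_coe huθ hlu⟩
  have hu₀θ : u₀ ≤ θ := by exact_mod_cast huθ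
  rw [EReal.toReal_coe, soloInformed_setLIntegral_comp_const_sub
    (soloInformed_measurableSet_EIoo _ _) _ θ, soloInformed_preimage_const_sub_EIoo]
  refine setLIntegral_congr_fun (soloInformed_measurableSet_EIoo _ _) (fun s hs => ?_)
  have hs0 : 0 < s := by
    have h1 := hs.1
    rw [EReal.coe_lt_coe_iff] at h1
    linarith
  simp only [sub_sub_cancel_left, abs_neg, abs_of_pos hs0]
  congr 1
  funext i
  rw [← abs_neg]
  congr 1
  ring

/-- Exclusion transfers to the normal variable (fibre above `θ`): a point `θ'` off the fibre
`(l, u)` gives `d = θ' - θ` off the normalised fibre `(l - θ, u - θ)`.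
[cite: BasuPollackRoy2006, §5.1] -/
theorem soloInformed_excluded_above {l u : EReal} {θ θ' : ℝ} (hθl : (θ : EReal) ≤ l) (hlu : l < u)
    (hθ' : θ' ∉ soloInformedEIoo l u) :
    ((θ' - θ : ℝ) : EReal) ≤ ((l.toReal - θ : ℝ) : EReal) ∨ u - θ ≤ ((θ' - θ : ℝ) : EReal) := by
  obtain ⟨l₀, rfl⟩ : ∃ l₀ : ℝ, l = (l₀ : EReal) := ⟨l.toReal, soloInformed_EIoo_lower_eq_coe hθl hlu⟩
  rw [EReal.toReal_coe]
  rcases soloInformed_EIoo_side hθ' with h | h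
  · left
    rw [EReal.coe_le_coe_iff] at h ⊢
    linarith
  · right
    induction u using EReal.rec with
    | bot => simp
    | coe u₀ =>
      rw [← EReal.coe_sub, EReal.coe_le_coe_iff]
      rw [EReal.coe_le_coe_iff] at h
      linarith
    | top => exact absurd h (by simp)

/-- Exclusion transfers to the normal variable (fibre below `θ`): a point `θ'` off the fibre
`(l, u)` gives `d = θ - θ'` off the normalised fibre `(θ - u, θ - l)`.
[cite: BasuPollackRoy2006, §5.1] -/
theorem soloInformed_excluded_below {l u : EReal} {θ θ' : ℝ} (huθ : u ≤ (θ : EReal)) (hlu : l < u)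
    (hθ' : θ' ∉ soloInformedEIoo l u) :
    ((θ - θ' : ℝ) : EReal) ≤ ((θ - u.toReal : ℝ) : EReal) ∨ (θ : EReal) - l ≤ ((θ - θ' : ℝ) : EReal) := by
  obtain ⟨u₀, rfl⟩ : ∃ u₀ : ℝ, u = (u₀ : EReal) := ⟨u.toReal, soloInformed_EIoo_upper_eq_coe huθ hlu⟩
  rw [EReal.toReal_coe]
  rcases soloInformed_EIoo_side hθ' with h | h
  · right
    induction l using EReal.rec with
    | bot => exact absurd h (by simp)
    | coe l₀ =>
      rw [← EReal.coe_sub, EReal.coe_le_coe_iff]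
      rw [EReal.coe_le_coe_iff] at h
      linarith
    | top => exact absurd hlu (by simp)
  · left
    rw [EReal.coe_le_coe_iff] at h ⊢
    linarith

end Summit.KontsevichZagierPeriods.KontsevichZagierPeriods.Theorems

end
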